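import Summits.QuantumFields.BalabanUV.T4Continuum.Support.NE3DecomposedRepOfLinearNormalPart
import Summits.QuantumFields.BalabanUV.T4Continuum.Support.NE3LinearNormalPartPreSizes
import Summits.QuantumFields.BalabanUV.T4Continuum.Support.NE3QuadRemainderFibre
import Summits.QuantumFields.BalabanUV.T4Continuum.Support.NE3ProductPathPlaquettes
import HarnessLib

/-!
# T⁴ programme, node NE3 — route Π, file 4 of D-ne3p1-g25-1 §4: THE JUNCTION — `DecomposedRep` FROM THE TWO TYPED LEAVES OF ROUTE Π
# (the R-adapted residual slice representative, the square-summable local sup majorant) AND KERNEL LETTERS (the linear normal part's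
# right-inverse letters, the tower class, window radii), everything else by name

NE3 (node U1b), row NE3 OWNER `b2b-balaban-t4-ne3-p1` (gen 25); rulings ρ-g25-1∕ρ-g25-2, design `D-ne3p1-g25-1.md`.  Inputs BY NAME: file 2
`NE3DecomposedRepOfLinearNormalPart.decomposedRep_of_linearNormalPart` (+ shape `ResidualSliceRepT`), file 3a `NE3LinearNormalPartPreSizes.preSizes_of_letters`,
leaf-02-g7's Π-C-3d `NE3QuadRemainderFibre.norm_dirIter_le_of_fibre_local` (the linearised average of the relative field of a fibre point is locally
quadratically small, on the dependency ball of record), leaf-04-g7's 3b `NE3ProductPathPlaquettes.small_of_residual_data_poly` (the moving plaquette radius),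
file 1's `NE3ResidualSliceRep` (`normalPart`, `norm_normalPart_sub_le`, `normalPart_skew`).

WHAT.  §1 (Π-REG)♭ `LocalSupMajorantBall` — the BALL form of the square-summable local sup majorant, matching the dependency set
`{y : l1 (y − L^k•z) ≤ depRad d L k}` of the landed local END (the box form `NE3LinearNormalPartPreSizes.LocalSupMajorant` is the sharper target; the ball
contains the box).  §2 **`decomposedRep_of_shapes`**: at a pair `(U_A, U_B)` of level `j+1`, background `W = cavg L U_B` in Π-C's tower class
(`2 ≤ L`, unitary, `(L^{j+1}·N)`-periodic, `LevelSmall d L (j+1) x`, `SmallField W x`, `curvSum d L (j+1) x ≤ (2∕3)L`), admissible for run A, with the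
fibre equation `cavgIter L (j+1) (W·e^{X₀}) = cavgIter L (j+1) W` (file 1 on `sfClass`), an R-ADAPTED RESIDUAL SLICE REPRESENTATIVE `(u, X₀, Nn, α₀)` [leaf],
a BALL MAJORANT `m ≤ α₀` of `X₀` with constant `C` [leaf], a linear normal part `Nn` (MEANT: `R_W(D_W X₀)`, leaf-01's smooth right inverse; generic here)
obeying the letters (R1)–(R4) against `φ := dirIter L (j+1) W X₀`, sup `αN` and window sup-curl `aN`, window radii `xW` (of `W`) and `xA` (of
`U_A^u = W·e^{X₀}`), and the numeric lines — **`DecomposedRep 𝒞 L N (j+1) V U_A U_B u X N α αN′ ν κ₁ κ₂ a`** holds with EVERY letter displayed and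
k-free in the currencies `α₀M`, `aM²`: `ν = (1+2048√(16d+1))·2√(c₁+c₂)·C₂·C·(α₀M)`, `C₂ = 4(3+12d)³∕rho0²`.

HONEST FRAMING.  Bookkeeping over landed kernel theorems; the two shapes, the fibre equation, the letters of `Nn`, the window radii and the numeric
lines are HYPOTHESES (suppliers: file 1 on `sfClass`; Π-R-W W5∕W6 for the curved right inverse — pending; the class; the K-road); (P♮)_W's numeric
lines, (H∃), T-E_w♯ and NE3 are NOT proved; spine PROVED 0∕9; finite T⁴ rung (B)+1 — NOT infinite volume, NOT mass gap, NOT `BetaPertH`, NOT Clay.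
PLACEMENT: `Summits/QuantumFields/BalabanUV/`.  HONEST DEPENDENCY: continuum YM on T⁴ ⇐ BetaPertH ∧ nine spine estimates (0/9 proved); BetaPertH ⇐
(D1) ∧ (D4) ∧ CAP+tail; G-an2-4 gates asym, D1 and NE2/3/4.
-/

set_option autoImplicit false

open scoped BigOperators Matrix.Norms.L2Operator
open NormedSpace Finset

namespace Summit.QuantumFields.BalabanUV.T4Continuum.NE3DecomposedRepOfShapes

open Set
open Literature.MathematicalPhysics.QuantumFieldTheory.Balaban1983to89
open B7Prop1Explicit B7Prop2Explicit MatrixLog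
open T4AveragingDeficitWall (IsSkewDir IsUnitaryCfg SmallField vary curl curlSq dirSq dirL1 fhol)
open T4AveragingDeficitWallBoundary (IsPeriodicCfg periodBox)
open AveragingDeficitPeriodicCounting (IsPeriodicDir)
open AveragingDeficitChartCalculus (cavg)
open AveragingDeficitMultiLevelPrep (cavgIter LevelSmall)
open BlockAverageVaryDisc (rho0 rho0_pos)
open MinimalActionLevels (perWin)
open MinimalActionSandwich (admissible)
open NE3TangentCovariantTower (dirIter)
open NE3LinearisedAverageSup (curvSum)
open NE3QuadRemainderLocality (depRad)
open NE3QuadRemainderFibre (norm_dirIter_le_of_fibre_local)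
open NE3EnergyWeightedShapes (energyNormW energyNormW_nonneg)
open NE3EnergyRateWSupOfSlicePoincare (mem_frameFreeBlockLandauW_struct)
open NE3ProductPath (pathΓ)
open NE3ProductPathChart (DecomposedRep)
open NE3ProductPathPlaquettes (small_of_residual_data_poly)
open NE3ResidualSliceRep (normalPart norm_normalPart_sub_le normalPart_skew)
open NE3DecomposedRepOfLinearNormalPart (ResidualSliceRepT decomposedRep_of_linearNormalPart)
open NE3LinearNormalPartPreSizes (preSizes_of_letters)

noncomputable section

variable {d : ℕ} {n : Type*} [Fintype n] [DecidableEq n]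

/-! ## §1 (Π-REG)♭ — the square-summable local sup majorant, ball form -/

/-- **(Π-REG)♭ — A SQUARE-SUMMABLE LOCAL SUP MAJORANT, BALL FORM** at level `k` (period `N·L^k`): `0 ≤ m(z,κ)` dominates `‖X₀ b‖` for every bond
starting in the dependency ball `{y : l1 (y − L^k•z) ≤ depRad d L k}` of the `k`-fold average at `z`, and
`(L^k)^d·Σ_{z∈periodBox N}Σ_κ m(z,κ)² ≤ C²·dirSq X₀ (periodBox (N·L^k))`.  A hypothesis SHAPE asserted for nothing (B11 Thm 1∕Prop 2 regularity
TYPE for the relative field of a minimiser pair; ours in form). [folklore] -/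
@[folklore]
structure LocalSupMajorantBall (L N k : ℕ) (X₀ : Site d → Fin d → Matrix n n ℂ) (m : Site d → Fin d → ℝ) (C : ℝ) : Prop where
  /-- the majorant is non-negative -/
  nonneg : ∀ (z : Site d) (κ : Fin d), 0 ≤ m z κ
  /-- the majorant dominates the field on the dependency ball about `L^k•z` -/
  dom : ∀ (z : Site d) (κ : Fin d) (y : Site d) (μ : Fin d), l1 (y - ((L : ℤ) ^ k) • z) ≤ depRad d L k → ‖X₀ y μ‖ ≤ m z κ
  /-- the constant is non-negative -/
  hC : 0 ≤ C
  /-- SQUARE-SUMMABILITY -/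
  sq : ((L : ℝ) ^ k) ^ d * ∑ z ∈ periodBox (d := d) N, ∑ κ : Fin d, m z κ ^ 2 ≤ C ^ 2 * dirSq X₀ (periodBox (d := d) (N * L ^ k))

/-! ## §2 The junction -/

/-- **`DecomposedRep` FROM THE TWO LEAVES OF ROUTE Π AND KERNEL LETTERS.**  See the module docstring; all letters displayed. [folklore] -/
theorem decomposedRep_of_shapes [Nonempty n] {𝒞 : ℕ → _root_.Set (Site d → Fin d → (Matrix n n ℂ)ˣ)} {L N : ℕ} [NeZero N]
    (hL : 2 ≤ L) (hN : 1 ≤ N) (j : ℕ) {V UA UB : Site d → Fin d → (Matrix n n ℂ)ˣ} {x : ℝ}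
    -- the tower class at the background
    (hWu : IsUnitaryCfg (cavg L UB)) (hWP : IsPeriodicCfg (cavg L UB) ((L ^ (j + 1) * N : ℕ) : ℤ)) (hx : 0 ≤ x)
    (hsm : LevelSmall d L (j + 1) x) (hWx : SmallField (cavg L UB) x) (hA : curvSum d L (j + 1) x ≤ 2 / 3 * L)
    (admW : cavg L UB ∈ admissible 𝒞 L (j + 1) V)
    -- the R-adapted residual slice representative [leaf] and the fibre equation
    {u : Site d → (Matrix n n ℂ)ˣ} {X₀ Nn : Site d → Fin d → Matrix n n ℂ} {α₀ : ℝ}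
    (h : ResidualSliceRepT L N (j + 1) (cavg L UB) UA u X₀ Nn α₀) (hα₀ : α₀ ≤ 1 / 100)
    (hσ : 4 * (3 + 12 * (d : ℝ)) ^ 2 * (L : ℝ) ^ (j + 1) * α₀ ≤ rho0 d L ^ 2)
    (hfib : cavgIter L (j + 1) (vary (cavg L UB) X₀ 1) = cavgIter L (j + 1) (cavg L UB))
    -- the majorant [leaf]
    {m : Site d → Fin d → ℝ} {C : ℝ} (hm : LocalSupMajorantBall L N (j + 1) X₀ m C) (hmα : ∀ z κ, m z κ ≤ α₀)
    -- the linear normal part and its letters against `φ := dirIter L (j+1) W X₀`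
    {αN aN c₁ c₂ c₃ c₄ : ℝ} (hNP : IsPeriodicDir Nn ((N * L ^ (j + 1) : ℕ) : ℤ)) (hαN0 : 0 ≤ αN) (hNsup : ∀ y μ, ‖Nn y μ‖ ≤ αN)
    (hαN : αN ≤ 1 / 2700) (hJ1 : (α₀ + 43 * αN) * (L : ℝ) ^ (j + 1) ≤ 1)
    (haN : ∀ p ∈ perWin d (N * L ^ (j + 1)), ‖curl (cavg L UB) Nn p‖ ≤ aN) (haN0 : 0 ≤ aN)
    (hc₁ : 0 ≤ c₁) (hc₂ : 0 ≤ c₂) (hc₃ : 0 ≤ c₃) (hc₄ : 0 ≤ c₄)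
    (hR1 : dirSq Nn (periodBox (d := d) (N * L ^ (j + 1)))
      ≤ c₁ * (((L : ℝ) ^ (j + 1)) ^ d / ((L : ℝ) ^ (j + 1)) ^ 2) * dirSq (dirIter L (j + 1) (cavg L UB) X₀) (periodBox (d := d) N))
    (hR2 : curlSq (cavg L UB) Nn (periodBox (d := d) (N * L ^ (j + 1)))
      ≤ c₂ * (((L : ℝ) ^ (j + 1)) ^ d / ((L : ℝ) ^ (j + 1)) ^ 4) * dirSq (dirIter L (j + 1) (cavg L UB) X₀) (periodBox (d := d) N))
    (hR3 : ∑ p ∈ perWin d (N * L ^ (j + 1)), ‖curl (cavg L UB) Nn p‖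
      ≤ c₃ * (((L : ℝ) ^ (j + 1)) ^ d / ((L : ℝ) ^ (j + 1)) ^ 2) * dirL1 (dirIter L (j + 1) (cavg L UB) X₀) (periodBox (d := d) N))
    (hR4 : dirL1 Nn (periodBox (d := d) (N * L ^ (j + 1)))
      ≤ c₄ * (((L : ℝ) ^ (j + 1)) ^ d / (L : ℝ) ^ (j + 1)) * dirL1 (dirIter L (j + 1) (cavg L UB) X₀) (periodBox (d := d) N))
    -- the smallness of the ν-letter
    (hρ : 2 * (c₁ + c₂) * (4 * (3 + 12 * (d : ℝ)) ^ 3 / rho0 d L ^ 2) ^ 2 * C ^ 2 * (α₀ * (L : ℝ) ^ (j + 1)) ^ 2 ≤ 1 / 2)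
    -- window radii of `W` and of `U_A^u = W·e^{X₀}`
    {xW xA : ℝ} (hxW0 : 0 ≤ xW) (hxA0 : 0 ≤ xA)
    (hxW : ∀ p ∈ perWin d (N * L ^ (j + 1)), ‖((fhol (cavg L UB) p : (Matrix n n ℂ)ˣ) : Matrix n n ℂ) - 1‖ ≤ xW)
    (hxA : ∀ p ∈ perWin d (N * L ^ (j + 1)), ‖((fhol (vary (cavg L UB) X₀ 1) p : (Matrix n n ℂ)ˣ) : Matrix n n ℂ) - 1‖ ≤ xA) :
    DecomposedRep 𝒞 L N (j + 1) V UA UB u (fun y μ => Nn y μ - X₀ y μ) (normalPart X₀ fun y μ => Nn y μ - X₀ y μ)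
      (α₀ + αN) ((1 + 2048 * (α₀ + αN)) * αN)
      ((1 + 2048 * Real.sqrt (16 * d + 1)) * (2 * Real.sqrt (c₁ + c₂) * (4 * (3 + 12 * (d : ℝ)) ^ 3 / rho0 d L ^ 2) * C * (α₀ * (L : ℝ) ^ (j + 1))))
      (4 * c₃ * (4 * (3 + 12 * (d : ℝ)) ^ 3 / rho0 d L ^ 2) * C ^ 2
          * ((2 * xW + xA + 2 * aN + 4 * (2048 * (α₀ + αN) * αN) + 48 * α₀ ^ 2 + 1300 * ((α₀ + αN) + (1 + 2048 * (α₀ + αN)) * αN) ^ 2)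
            * ((L : ℝ) ^ (j + 1)) ^ 2)
        + 8192 * d * (4 * c₄ * (4 * (3 + 12 * (d : ℝ)) ^ 3 / rho0 d L ^ 2) * C ^ 2
          * ((2 * xW + xA + 2 * aN + 4 * (2048 * (α₀ + αN) * αN) + 48 * α₀ ^ 2 + 1300 * ((α₀ + αN) + (1 + 2048 * (α₀ + αN)) * αN) ^ 2)
            * ((L : ℝ) ^ (j + 1)) ^ 2)))
      (1806 * (4 * c₄ * (4 * (3 + 12 * (d : ℝ)) ^ 3 / rho0 d L ^ 2) * C ^ 2
          * ((2 * xW + xA + 2 * aN + 4 * (2048 * (α₀ + αN) * αN) + 48 * α₀ ^ 2 + 1300 * ((α₀ + αN) + (1 + 2048 * (α₀ + αN)) * αN) ^ 2)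
            * ((L : ℝ) ^ (j + 1)) ^ 2)))
      (2 * xW + xA + 2 * aN + 4 * (2048 * (α₀ + αN) * αN) + 48 * α₀ ^ 2 + 1300 * ((α₀ + αN) + (1 + 2048 * (α₀ + αN)) * αN) ^ 2) := by
  have hL1 : 1 ≤ L := by omega
  -- the constant of Π-C and the plaquette radius, as reals
  set C₂ : ℝ := 4 * (3 + 12 * (d : ℝ)) ^ 3 / rho0 d L ^ 2 with hC₂def
  set a : ℝ := 2 * xW + xA + 2 * aN + 4 * (2048 * (α₀ + αN) * αN) + 48 * α₀ ^ 2
    + 1300 * ((α₀ + αN) + (1 + 2048 * (α₀ + αN)) * αN) ^ 2 with hadef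
  have hρ0 : 0 < rho0 d L := rho0_pos (d := d) hL1
  have hC₂0 : 0 ≤ C₂ := by rw [hC₂def]; positivity
  have hα₀0 : 0 ≤ α₀ := h.hα₀
  have ha0 : 0 ≤ a := by rw [hadef]; positivity
  -- structural data of the tangent datum `X := Nn − X₀`
  obtain ⟨hXs, hXP, -⟩ := mem_frameFreeBlockLandauW_struct h.tangent
  have hXP' : IsPeriodicDir X₀ ((L ^ (j + 1) * N : ℕ) : ℤ) := by rw [Nat.mul_comm]; exact h.per
  -- (1) the local quadratic letter `hφ` from the fibre equation, the local END and the majorant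
  have hφ : ∀ z ∈ periodBox (d := d) N, ∀ κ : Fin d,
      ‖dirIter L (j + 1) (cavg L UB) X₀ z κ‖ ≤ C₂ * ((L : ℝ) ^ (j + 1) * m z κ) ^ 2 := by
    intro z _ κ
    have hσz : 4 * (3 + 12 * (d : ℝ)) ^ 2 * (L : ℝ) ^ (j + 1) * m z κ ≤ rho0 d L ^ 2 :=
      (mul_le_mul_of_nonneg_left (hmα z κ) (by positivity)).trans hσ
    have := norm_dirIter_le_of_fibre_local hL hWu hWP hx hsm hWx hA h.skew hXP' hα₀0 h.sup hσ hfib z (hm.nonneg z κ)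
      (hm.dom z κ) hσz κ
    rw [hC₂def]; exact this
  -- (2) the pre-sizes of `Nn` from the letters
  have hsL : (α₀ + αN) * (L : ℝ) ^ (j + 1) ≤ 1 := by
    have h1 : α₀ + αN ≤ α₀ + 43 * αN := by linarith
    exact (mul_le_mul_of_nonneg_right h1 (by positivity)).trans hJ1
  obtain ⟨hN1, hN2, hN3⟩ := preSizes_of_letters (N := N) hL1 (j + 1) (cavg L UB) (X₀ := X₀) (Nn := Nn)
    (φ := dirIter L (j + 1) (cavg L UB) X₀) (m := m) (C₂ := C₂) (C := C) (a := a)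
    hα₀0 hαN0 hC₂0 hm.hC hc₁ hc₂ hc₃ hc₄ ha0 hm.nonneg hmα hm.sq hφ hR1 hR2 hR3 hR4 (by rw [hC₂def]; exact hρ) hsL
  -- (3) the moving plaquette radius from 3b
  have hs32 : α₀ + αN < 1 / 32 := by linarith
  have hXsup : ∀ y μ, ‖Nn y μ - X₀ y μ‖ ≤ α₀ + αN := fun y μ =>
    (norm_sub_le _ _).trans (by rw [add_comm]; exact add_le_add (h.sup y μ) (hNsup y μ))
  have hX32 : ∀ y μ, ‖Nn y μ - X₀ y μ‖ ≤ 1 / 32 := fun y μ => (hXsup y μ).trans hs32.le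
  have hX₀32 : ∀ y μ, ‖X₀ y μ‖ ≤ 1 / 32 := fun y μ => (h.sup y μ).trans (by linarith)
  have hNgs : IsSkewDir (normalPart X₀ fun y μ => Nn y μ - X₀ y μ) := normalPart_skew h.skew hXs hX₀32 hX32
  have hαN32 : αN < 1 / 32 := by linarith
  have hNgsub : ∀ y μ, ‖normalPart X₀ (fun y μ => Nn y μ - X₀ y μ) y μ - Nn y μ‖ ≤ 2048 * (α₀ + αN) * αN := by
    intro y μ
    have hb := norm_normalPart_sub_le (X₀ := X₀) (Nn := Nn) (y := y) (μ := μ) ((hXsup y μ).trans_lt hs32)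
      ((hNsup y μ).trans_lt hαN32)
    have h1 : 0 ≤ ‖Nn y μ‖ := norm_nonneg _
    have hs0 : 0 ≤ α₀ + αN := by positivity
    have h2 : ‖Nn y μ - X₀ y μ‖ * ‖Nn y μ‖ ≤ (α₀ + αN) * αN := mul_le_mul (hXsup y μ) (hNsup y μ) h1 hs0
    have h3 : 2048 * ‖Nn y μ - X₀ y μ‖ * ‖Nn y μ‖ ≤ 2048 * (α₀ + αN) * αN := by
      have := mul_le_mul_of_nonneg_left h2 (by norm_num : (0:ℝ) ≤ 2048)
      linarith [this]
    exact hb.trans h3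
  have hNgsup : ∀ y μ, ‖normalPart X₀ (fun y μ => Nn y μ - X₀ y μ) y μ‖ ≤ (1 + 2048 * (α₀ + αN)) * αN := by
    intro y μ
    calc ‖normalPart X₀ (fun y μ => Nn y μ - X₀ y μ) y μ‖
        = ‖(normalPart X₀ (fun y μ => Nn y μ - X₀ y μ) y μ - Nn y μ) + Nn y μ‖ := by rw [sub_add_cancel]
      _ ≤ ‖normalPart X₀ (fun y μ => Nn y μ - X₀ y μ) y μ - Nn y μ‖ + ‖Nn y μ‖ := norm_add_le _ _
      _ ≤ 2048 * (α₀ + αN) * αN + αN := add_le_add (hNgsub y μ) (hNsup y μ)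
      _ = (1 + 2048 * (α₀ + αN)) * αN := by ring
  have h42 : 1 + 2048 * (α₀ + αN) ≤ 42 := by linarith
  have hαN' : (1 + 2048 * (α₀ + αN)) * αN ≤ 1 / 64 := by
    have hb : (1 + 2048 * (α₀ + αN)) * αN ≤ 42 * αN := mul_le_mul_of_nonneg_right h42 hαN0
    linarith
  have hsmall : ∀ t ∈ Icc (0:ℝ) 1, ∀ p ∈ perWin d (N * L ^ (j + 1)),
      ‖((fhol (vary (cavg L UB) (pathΓ (fun y μ => Nn y μ - X₀ y μ) (normalPart X₀ fun y μ => Nn y μ - X₀ y μ) t) 1) p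
        : (Matrix n n ℂ)ˣ) : Matrix n n ℂ) - 1‖ ≤ a := by
    intro t ht p hp
    have h3b := small_of_residual_data_poly hWu h.skew hXs hNgs (X₀ := X₀) (Nn := Nn) (fun _ _ => rfl) hNgsub h.sup
      (by linarith) hXsup hNgsup hs32.le hαN' (perWin d (N * L ^ (j + 1))) hxW hxA haN ht p hp
    rw [hadef]; exact h3b
  -- (4) file 2
  exact decomposedRep_of_linearNormalPart hL1 hN j hWu admW h hα₀ hNP hαN0 hNsup hαN hJ1 ha0 hN1 hN2 hN3 hsmall

end

end Summit.QuantumFields.BalabanUV.T4Continuum.NE3DecomposedRepOfShapes
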